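import Literature.NumberTheory.LFunctions.LevinsonMontgomeryTheoremProofs
import Literature.NumberTheory.LFunctions.RiemannHypothesisUpTo100000X
import Literature.NumberTheory.LFunctions.RiemannHypothesisUpTo1000X
import HarnessLib

/-!
# `ζ′(s) ≠ 0` in the left half `0 < Re s < ½` of the critical strip up to height `99 999.5` —
# the Levinson–Montgomery sign theorem at the tree's certified heights `10⁵` (compiled) and `10³` (kernel)

Topic `Literature/NumberTheory/LFunctions`. Companion of `RHCriteriaRangesRS.lean` and
`JensenHyperbolicityRangesRS.lean` (named cases of RH criteria from the same heights). One further
"verified height ⇒ named case" reduction of the tree, with a real proof, is instantiated at the two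
heights of `ζ` that the tree certifies WITHOUT any named fact:

* **Levinson–Montgomery** (Acta Math. 133 (1974), §2; tree `re_logDeriv_riemannZeta_neg_of_lmGood'`,
  `LevinsonMontgomeryTheorem.lean`, proved): `Re ζ′/ζ(σ + it) < 0` for `0 ≤ σ < ½`, `|t| ≥ 10`,
  whenever `t` is a *good* height (distance `≥ ½` from the ordinate of every zero of `ζ` off the
  critical line, `lmGood`). The Riemann hypothesis in the strip up to height `T′` makes every
  `|t| ≤ T′ − ½` good (`lmGood_of_riemannHypothesisInStripUpTo`, `LevinsonMontgomeryTheoremProofs.lean`).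
  At `T′ = 10⁵` (`riemannHypothesisInStripUpTo_100000`, `RiemannHypothesisUpTo100000X.lean`:
  Riemann–Siegel sign certificate of the `138 069` zeros with the PROVED remainder bound + Turing's
  method, compiled evaluation) this gives **`Re ζ′/ζ(s) < 0`, hence `ζ′(s) ≠ 0`, for every
  `0 ≤ Re s < ½`, `10 ≤ |Im s| ≤ 99 999.5`** (`deriv_riemannZeta_ne_zero_of_abs_im_le_199999_half`);
  with the tree's certified low heights `0 < |t| ≤ 10` (`deriv_riemannZeta_ne_zero_lowHeight`,
  Euler–Maclaurin enclosures and winding certificates, kernel) the whole left half-strip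
  `0 < Re s < ½`, `0 < |Im s| ≤ 99 999.5` is free of zeros of `ζ′`
  (`deriv_riemannZeta_ne_zero_leftHalfStrip_of_le_199999_half`). At the KERNEL height `T′ = 10³`
  (`riemannHypothesisUpTo_1000`, `RiemannHypothesisUpTo1000X.lean`, the same certificate format checked
  by `decide +kernel`, standard axioms) the range is `0 < |Im s| ≤ 999.5`
  (`deriv_riemannZeta_ne_zero_leftHalfStrip_of_le_1999_half`). Before this file the tree had the
  statement for `0 < |Im s| ≤ 100` (`spira1965_deriv_riemannZeta_ne_zero_holds`, from `RH` to height
  `101`), which is the range Spira reported on (Illinois J. Math. 17 (1973), p. 149: computed for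
  `|t| ≤ 200`, reported for `|t| ≤ 100`). By Levinson–Montgomery / Speiser, `ζ′ ≠ 0` on the whole open
  left half-strip is EQUIVALENT to RH (tree `speiser_iff`); nothing beyond the stated heights follows.

Also recorded: the two-sided strip form of the kernel height, `riemannHypothesisInStripUpTo_1000`
(the `10⁵` and `10⁴` strip forms are in `RiemannHypothesisUpTo100000X.lean` / `RiemannHypothesisUpTo10000EM.lean`).

Auxiliary axioms: the `10⁵` statements inherit the compiled-evaluation axioms (`Lean.ofReduceBool`,
`Lean.trustCompiler`) of `riemannHypothesisUpTo_100000` (16 `native_decide` data checks, listed in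
`RiemannHypothesisUpTo100000X.lean`); the `10³` statements are kernel-checked, standard axioms only.

## References

* [LevinsonMontgomery1974] N. Levinson, H. L. Montgomery, *Zeros of the derivatives of the Riemann
  zeta-function*, Acta Math. 133 (1974) 49–65, §2 (Theorem 1 and the sign of `Re ζ′/ζ`).
* [Spira1973] R. Spira, *Zeros of `ζ′(s)` and the Riemann hypothesis*, Illinois J. Math. 17 (1973)
  147–152, p. 149.
* [Brent1979] R. P. Brent, Math. Comp. 33 (1979), §4 (the sign-certificate + Turing format).
-/

noncomputable section

namespace Literature.NumberTheory.LFunctions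

open Complex

/-! ### The kernel height `10³` in strip form -/

/-- The two-sided strip form of the kernel-certified height `10³`: every zero of `ζ` with
`0 < Re ρ < 1` and `|Im ρ| ≤ 1000` has `Re ρ = ½` (kernel-checked, standard axioms, no named fact;
`riemannHypothesisUpTo_1000` and `riemannHypothesisInStripUpTo_iff_holds`). [cite: Brent1979, §4] -/
theorem riemannHypothesisInStripUpTo_1000 : RiemannHypothesisInStripUpTo 1000 :=
  (riemannHypothesisInStripUpTo_iff_holds 1000).2 riemannHypothesisUpTo_1000

/-! ### Good heights -/

/-- Every height `|t| ≤ 99 999.5` is good in the sense of Levinson–Montgomery (distance `≥ ½` from the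
ordinate of every zero of `ζ` off the critical line) — unconditionally, compiled evaluation
(`riemannHypothesisInStripUpTo_100000`). [cite: LevinsonMontgomery1974, §2] -/
theorem lmGood_of_abs_le_199999_half {t : ℝ} (ht : |t| ≤ 199999 / 2) : lmGood t :=
  lmGood_of_riemannHypothesisInStripUpTo riemannHypothesisInStripUpTo_100000 (by linarith)

/-- Every height `|t| ≤ 999.5` is good — kernel-checked, standard axioms
(`riemannHypothesisInStripUpTo_1000`). [cite: LevinsonMontgomery1974, §2] -/
theorem lmGood_of_abs_le_1999_half {t : ℝ} (ht : |t| ≤ 1999 / 2) : lmGood t :=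
  lmGood_of_riemannHypothesisInStripUpTo riemannHypothesisInStripUpTo_1000 (by linarith)

/-! ### The sign of `Re ζ′/ζ` and `ζ′ ≠ 0` for `10 ≤ |t| ≤ 99 999.5` -/

/-- **`Re ζ′/ζ(s) < 0` for `0 ≤ Re s < ½`, `10 ≤ |Im s| ≤ 99 999.5`** — Levinson–Montgomery's sign
theorem at good heights (`re_logDeriv_riemannZeta_neg_of_lmGood'`), every such height being good by
`RH` in the strip up to `10⁵` (unconditional, compiled evaluation). [cite: LevinsonMontgomery1974, §2] -/
theorem re_logDeriv_riemannZeta_neg_of_abs_im_le_199999_half {s : ℂ} (h0 : 0 ≤ s.re)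
    (h1 : s.re < 1 / 2) (ht : 10 ≤ |s.im|) (hT : |s.im| ≤ 199999 / 2) :
    (logDeriv riemannZeta s).re < 0 :=
  re_logDeriv_riemannZeta_neg_of_lmGood' (lmGood_of_abs_le_199999_half hT) ht h0 h1

/-- **`ζ′(s) ≠ 0` for `0 ≤ Re s < ½`, `10 ≤ |Im s| ≤ 99 999.5`** (unconditional, compiled evaluation).
[cite: LevinsonMontgomery1974, §2] -/
theorem deriv_riemannZeta_ne_zero_of_abs_im_le_199999_half {s : ℂ} (h0 : 0 ≤ s.re)
    (h1 : s.re < 1 / 2) (ht : 10 ≤ |s.im|) (hT : |s.im| ≤ 199999 / 2) :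
    deriv riemannZeta s ≠ 0 :=
  (ne_zero_of_re_logDeriv_neg (re_logDeriv_riemannZeta_neg_of_abs_im_le_199999_half h0 h1 ht hT)).2

/-- `Re ζ′/ζ(s) < 0` for `0 ≤ Re s < ½`, `10 ≤ |Im s| ≤ 999.5` — KERNEL-checked, standard axioms
(`riemannHypothesisInStripUpTo_1000`). [cite: LevinsonMontgomery1974, §2] -/
theorem re_logDeriv_riemannZeta_neg_of_abs_im_le_1999_half {s : ℂ} (h0 : 0 ≤ s.re)
    (h1 : s.re < 1 / 2) (ht : 10 ≤ |s.im|) (hT : |s.im| ≤ 1999 / 2) :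
    (logDeriv riemannZeta s).re < 0 :=
  re_logDeriv_riemannZeta_neg_of_lmGood' (lmGood_of_abs_le_1999_half hT) ht h0 h1

/-- `ζ′(s) ≠ 0` for `0 ≤ Re s < ½`, `10 ≤ |Im s| ≤ 999.5` — KERNEL-checked, standard axioms.
[cite: LevinsonMontgomery1974, §2] -/
theorem deriv_riemannZeta_ne_zero_of_abs_im_le_1999_half {s : ℂ} (h0 : 0 ≤ s.re)
    (h1 : s.re < 1 / 2) (ht : 10 ≤ |s.im|) (hT : |s.im| ≤ 1999 / 2) :
    deriv riemannZeta s ≠ 0 :=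
  (ne_zero_of_re_logDeriv_neg (re_logDeriv_riemannZeta_neg_of_abs_im_le_1999_half h0 h1 ht hT)).2

/-! ### The whole left half-strip up to the certified heights -/

/-- **`ζ′` has no zeros in the left half of the critical strip up to height `99 999.5`**:
`ζ′(s) ≠ 0` for `0 < Re s < ½`, `0 < |Im s| ≤ 99 999.5` — unconditionally (compiled evaluation for the
heights `100 < |t| ≤ 99 999.5`; the heights `0 < |t| ≤ 100` are the tree's kernel-checked discharge of
Spira's statement, `spira1965_deriv_riemannZeta_ne_zero_holds`). Spira's reported range was
`|t| ≤ 100`. [cite: Spira1973, p. 149 (the statement shape); LevinsonMontgomery1974, §2 (the method)] -/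
theorem deriv_riemannZeta_ne_zero_leftHalfStrip_of_le_199999_half :
    ∀ s : ℂ, 0 < s.re → s.re < 1 / 2 → 0 < |s.im| → |s.im| ≤ 199999 / 2 →
      deriv riemannZeta s ≠ 0 := by
  intro s h0 h1 ht hT
  rcases le_or_gt (|s.im|) 100 with h100 | h100
  · exact spira1965_deriv_riemannZeta_ne_zero_holds s h0 h1 ht h100
  · exact deriv_riemannZeta_ne_zero_of_abs_im_le_199999_half h0.le h1 (by linarith) hT

/-- `ζ′(s) ≠ 0` for `0 < Re s < ½`, `0 < |Im s| ≤ 999.5` — KERNEL-checked, standard axioms only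
(`riemannHypothesisUpTo_1000` for `100 < |t| ≤ 999.5`, `spira1965_deriv_riemannZeta_ne_zero_holds` below).
[cite: Spira1973, p. 149 (the statement shape); LevinsonMontgomery1974, §2 (the method)] -/
theorem deriv_riemannZeta_ne_zero_leftHalfStrip_of_le_1999_half :
    ∀ s : ℂ, 0 < s.re → s.re < 1 / 2 → 0 < |s.im| → |s.im| ≤ 1999 / 2 →
      deriv riemannZeta s ≠ 0 := by
  intro s h0 h1 ht hT
  rcases le_or_gt (|s.im|) 100 with h100 | h100
  · exact spira1965_deriv_riemannZeta_ne_zero_holds s h0 h1 ht h100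
  · exact deriv_riemannZeta_ne_zero_of_abs_im_le_1999_half h0.le h1 (by linarith) hT

/-- Height sanity: `99 999.5 = 10⁵ − ½` and `999.5 = 10³ − ½` are exactly the ranges
`lmGood_of_riemannHypothesisInStripUpTo` yields from the strip heights `10⁵` and `10³`. [folklore] -/
example : (199999 / 2 : ℝ) = 100000 - 1 / 2 ∧ (1999 / 2 : ℝ) = 1000 - 1 / 2 := by norm_num

end Literature.NumberTheory.LFunctions

end
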